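import Literature.Computability.AlgebraicComplexity.LowDepthRankBound
import Literature.Computability.AlgebraicComplexity.StandardFamilies
import HarnessLib

/-!
# The LST relative-rank pipeline is blind to the permanent

Route `Depth4`, lens 4 «depth-reduction / chasm axis» of the `decomp-valiant` workshop, gen 26 (OFFER O19, CALL
1453), in support of `stmt-ValiantsHypothesis-11333` (`Depth4HomFour`).  Sorry-free; one certificate-shape
`def : Prop` (the class), no Literature fact, no instance.  CURRENCY = the tree's LST engine
`LSTWord.relRank_aeval_eval_le`: a word (`d` blocks, `10 d ≤ k`, sign pattern `pos`; block `b` = `BlockVar k pos b`,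
`2^{|w_b|}` variables, `|w_b| = letterSize k pos b`), a block-preserving substitution `g` of the target's variables
by block-linear forms, the measure `relRank K pos univ`, the class bound `Lam s N d Δ · Phi k Δ d`.
§1 `LSTCertifies blk₀ F s Δ` (some word and `g` put `relrk(g(F))` STRICTLY ABOVE the class bound at size `s`);
SOUNDNESS `size_lt_of_lstCertifies` = the engine by name + `Λ` monotone in `s`.  §2 FEWNOMIAL BOUND
`relrk_{[d]}(g(Σ_{j∈J} a_j ∏_i X_{e j i})) ≤ |J| · 2^{-L/2}`, `L = Σ_b |w_b|`: over a BIJECTIVE block pattern a term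
is a product of block-linear forms in distinct blocks, `relrk = ∏_b relrk_{{b}} ≤ ∏_b 2^{-|w_b|/2}`
(multiplicativity + imbalance); over a NON-bijective one its set-multilinear part is `0` (block-linearity of `g`
is load-bearing); sub-additivity.  §3 NUMERICS `L ≥ d ⌊k/√2⌋ ≥ d (0.7 k - 1)`, `k ≥ 10 d`, `d^{μ_Δ} ≤ d` ⇒
`|J| · 2^{-L/2} ≤ Phi ≤ Lam · Phi` for `|J| ≤ 2^{2d²}`, `d ≥ 1` (`d = 0`: `relrk ≤ 1 ≤ Lam`; `|ι'| ≠ d`: measure `0`)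
⇒ `not_lstCertifies_sum`: NO certificate at ANY size `s` (even `s = 0`), `Δ`, block map, field; §4 `per_n`, `det_n`
for ALL `n d blk₀ s Δ` (`n! ≤ 2^{2n²}` terms).
SCOPE: direct pipeline only; transported LST∘(IMM ≤_p per) not covered; BDS method-level cap is a different statement.
(Transported LST: kernel floor `perHardConstDepth` (lineage 4, g2), quasi-polynomial reach by the paper's constraint
`2^{|w_i|} ≤ m` — paper remark; BDS bounds the METHOD on every target.)  Grade: method ceiling of the cheapest kind
(fewnomial blindness), KNOWN in spirit (LST 2021 §1/§8; BDS 2024), kernel-new as an `s`-free vacuity theorem in the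
tree's LST currency; NOT about depth reduction or the complexity of `per`; `Depth4HomFour` stays open; nothing
here bears on `VP ≠ VNP`.
-/

set_option linter.dupNamespace false

namespace Summit.ValiantsHypothesis.ValiantsHypothesis.Theorems.LSTPipelinePer

open MvPolynomial Finsupp Literature.Computability.AlgebraicComplexity
open Literature.Computability.AlgebraicComplexity.LSTWord

noncomputable section

variable {K : Type*} [Field K]

/-- **LST certificate** for `size > s` against product-depth-`Δ` circuits computing `F` (block map
`blk₀ : σ₀ → Fin d`): a word (`k`, `pos`, `10 d ≤ k`) and a block-preserving substitution `g` into its blocks with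
`relrk_{[d]}(g(F))` above the class bound `Λ_Δ(s,|σ₀|,d) · 2^{-k d^{μ_Δ}/20}`.  A DEFINITION of the certificate
shape (a local construction, assumed nowhere), not a named fact. [cite: LimayeSrinivasanTavenas2025, Lemma 15] -/
def LSTCertifies {σ₀ : Type} [Fintype σ₀] {d : ℕ} (blk₀ : σ₀ → Fin d) (F : MvPolynomial σ₀ K)
    (s Δ : ℕ) : Prop :=
  ∃ (k : ℕ) (pos : Fin d → Bool) (g : σ₀ → MvPolynomial (Σ i : Fin d, BlockVar k pos i) K),
    10 * d ≤ k ∧ IsBlockPreserving blk₀ Sigma.fst g ∧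
      Lam s (Fintype.card σ₀) d Δ * Phi k Δ d < relRank K pos Finset.univ (aeval g F)

/-- **Soundness**: an LST certificate at `s` excludes every product-depth-`≤ Δ` circuit of size `≤ s`
computing `F` (characteristic `0`, `d ≥ 1`); the engine by name plus monotonicity of `Λ_Δ(·, N, d)` in the
size (inlined: as a declaration it is `BarrierLeverDefinableEquations.LSTSlice.Lam_mono`, whose module is not
imported here to keep this file's import cone to the LST engine). [cite: LimayeSrinivasanTavenas2025, Lemma 15] -/
theorem size_lt_of_lstCertifies [CharZero K] {σ₀ : Type} [Fintype σ₀] {d : ℕ} {blk₀ : σ₀ → Fin d}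
    {F : MvPolynomial σ₀ K} {s Δ : ℕ} (hd : 1 ≤ d) (h : LSTCertifies blk₀ F s Δ)
    (P : ArithCircuit K σ₀) (hP : P.eval = F) (hΔ : P.productDepth ≤ Δ) : s < P.size := by
  obtain ⟨k, pos, g, hk, hg, hlt⟩ := h
  by_contra hs
  have h1 := relRank_aeval_eval_le hg hk hd hΔ
  rw [hP] at h1
  have hst : stepConst P.size (Fintype.card σ₀) d ≤ stepConst s (Fintype.card σ₀) d := by
    unfold stepConst
    have h2 := Nat.mul_le_mul_right ((d + 1) ^ (5 * d + 1)) (Nat.mul_le_mul (by omega) (by omega) :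
      (P.size + 1) * (P.size + Fintype.card σ₀ + 1) ≤ (s + 1) * (s + Fintype.card σ₀ + 1))
    omega
  replace hst : (stepConst P.size (Fintype.card σ₀) d : ℝ) ≤ stepConst s (Fintype.card σ₀) d := by
    exact_mod_cast hst
  have h2 : Lam P.size (Fintype.card σ₀) d Δ * Phi k Δ d ≤ Lam s (Fintype.card σ₀) d Δ * Phi k Δ d := by
    rw [Lam_eq, Lam_eq]
    exact mul_le_mul_of_nonneg_right
      (mul_le_mul_of_nonneg_right (pow_le_pow_left₀ (Nat.cast_nonneg _) hst Δ) (by positivity)) (Phi_pos _ _ _).le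
  exact (not_lt.2 (h1.trans h2)) hlt

/-- `g(Σ_j a_j ∏_i X_{e j i}) = Σ_j a_j ∏_i g(e j i)`. [folklore] -/
theorem aeval_sum_smul_prod_X {σ₀ τ : Type*} (g : σ₀ → MvPolynomial τ K) {J ι' : Type*}
    [Fintype J] [Fintype ι'] (a : J → K) (e : J → ι' → σ₀) :
    aeval g (∑ j, a j • ∏ i, (X (e j i) : MvPolynomial σ₀ K)) = ∑ j, a j • ∏ i, g (e j i) := by
  rw [map_sum]
  refine Finset.sum_congr rfl fun j _ => ?_
  rw [MvPolynomial.smul_eq_C_mul, map_mul, MvPolynomial.aeval_C, map_prod, Algebra.smul_def]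
  simp only [MvPolynomial.aeval_X]

section Word

variable {d k : ℕ} {pos : Fin d → Bool} {σ₀ : Type} {blk₀ : σ₀ → Fin d}
  {g : σ₀ → MvPolynomial (Σ i : Fin d, BlockVar k pos i) K}

variable (k pos) in
/-- `relrk_{w|{b}}(f) ≤ 2^{-|w_b|/2}` (imbalance on one block). [cite: LimayeSrinivasanTavenas2025, Claim 7] -/
theorem relRank_singleton_le (b : Fin d) (f : MvPolynomial (Σ i, BlockVar k pos i) K) :
    relRank K pos {b} f ≤ (2 : ℝ) ^ (-(letterSize k pos b : ℝ) / 2) := by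
  have h := relRank_le_two_pow_wsum k pos {b} f
  have hw : |(wsum k pos {b} : ℝ)| = (letterSize k pos b : ℝ) := by
    by_cases hp : pos b = true <;> simp [wsum, wt, letterSize, hp]
  rwa [hw] at h

/-- BIJECTIVE block pattern: `relrk_{[d]}(∏_i g(e i)) ≤ 2^{-(Σ_b |w_b|)/2}`. [cite: LimayeSrinivasanTavenas2025, Claim 7] -/
theorem relRank_prod_le_of_bijective (hg : IsBlockPreserving blk₀ Sigma.fst g) {ι' : Type}
    [Fintype ι'] (e : ι' → σ₀) (hb : Function.Bijective fun i => blk₀ (e i)) :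
    relRank K pos Finset.univ (∏ i, g (e i)) ≤ (2 : ℝ) ^ (-((∑ b : Fin d, letterSize k pos b : ℕ) : ℝ) / 2) := by
  classical
  have hdisj : (↑(Finset.univ : Finset ι') : Set ι').PairwiseDisjoint fun i => ({blk₀ (e i)} : Finset (Fin d)) := by
    intro i _ j _ hij
    change Disjoint ({blk₀ (e i)} : Finset (Fin d)) {blk₀ (e j)}
    rw [Finset.disjoint_singleton_left, Finset.mem_singleton]
    exact fun h => hij (hb.1 h)
  have hsml : ∀ i ∈ (Finset.univ : Finset ι'), IsSetMultilinear Sigma.fst ({blk₀ (e i)} : Finset (Fin d)) (g (e i)) :=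
    fun i _ => by unfold IsSetMultilinear; rw [blockProfile_singleton]; exact hg (e i)
  have hU : (Finset.univ : Finset ι').biUnion (fun i => ({blk₀ (e i)} : Finset (Fin d))) = Finset.univ :=
    Finset.eq_univ_of_forall fun c => by
      obtain ⟨i, hi⟩ := hb.2 c
      exact Finset.mem_biUnion.2 ⟨i, Finset.mem_univ i, Finset.mem_singleton.2 hi.symm⟩
  have hprod := relRank_finset_prod pos Finset.univ (fun i => ({blk₀ (e i)} : Finset (Fin d))) (fun i => g (e i))
    hdisj hsml
  rw [hU] at hprod
  have hsum : ∑ i, letterSize k pos (blk₀ (e i)) = ∑ b, letterSize k pos b := hb.sum_comp fun b => letterSize k pos b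
  have hhalf : ∀ L : ℕ, (2 : ℝ) ^ (-(L : ℝ) / 2) = ((2 : ℝ) ^ (-(1 / 2 : ℝ))) ^ L := fun L => by
    rw [← Real.rpow_natCast, ← Real.rpow_mul (by norm_num : (0 : ℝ) ≤ 2)]
    exact congrArg _ (by ring)
  refine (le_of_eq hprod).trans ?_
  calc ∏ i, relRank K pos {blk₀ (e i)} (g (e i)) ≤ ∏ i, (2 : ℝ) ^ (-(letterSize k pos (blk₀ (e i)) : ℝ) / 2) :=
        Finset.prod_le_prod (fun i _ => relRank_nonneg pos _ _) fun i _ => relRank_singleton_le k pos (blk₀ (e i)) _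
    _ = (2 : ℝ) ^ (-((∑ b : Fin d, letterSize k pos b : ℕ) : ℝ) / 2) := by
        simp_rw [hhalf]
        rw [Finset.prod_pow_eq_pow_sum, hsum]

/-- NON-bijective block pattern: `relrk_{[d]}(∏_i g(e i)) = 0`. [cite: LimayeSrinivasanTavenas2025, §2.1] -/
theorem relRank_prod_eq_zero_of_not_bijective (hg : IsBlockPreserving blk₀ Sigma.fst g) {ι' : Type}
    [Fintype ι'] (e : ι' → σ₀) (hb : ¬ Function.Bijective fun i => blk₀ (e i)) :
    relRank K pos Finset.univ (∏ i, g (e i)) = 0 := by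
  classical
  have hT : IsWeightedHomogeneous (blockWeight Sigma.fst) (∏ i, g (e i)) (∑ i, single (blk₀ (e i)) 1) :=
    IsWeightedHomogeneous.prod Finset.univ (fun i => g (e i)) (fun i => single (blk₀ (e i)) 1) fun i _ => hg (e i)
  have hne : blockProfile (Finset.univ : Finset (Fin d)) ≠ ∑ i, single (blk₀ (e i)) 1 := by
    intro heq
    have hcnt : ∀ c : Fin d, (Finset.univ.filter fun i => blk₀ (e i) = c).card = 1 := by
      intro c
      have h1 := DFunLike.congr_fun heq c
      rw [blockProfile_apply, if_pos (Finset.mem_univ c), Finsupp.finsetSum_apply] at h1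
      rw [Finset.card_filter]
      refine Eq.trans (Finset.sum_congr rfl fun i _ => ?_) h1.symm
      rw [Finsupp.single_apply]
      try congr 1
    refine hb ⟨fun i j hij => ?_, fun c => ?_⟩
    · exact Finset.card_le_one.1 (hcnt (blk₀ (e i))).le i (by simp) j (by simpa using hij.symm)
    · obtain ⟨i, hi⟩ := Finset.card_pos.1 (by rw [hcnt c]; exact Nat.one_pos)
      exact ⟨i, (Finset.mem_filter.1 hi).2⟩
  have hzero : smlProj Sigma.fst (Finset.univ : Finset (Fin d)) (∏ i, g (e i)) = 0 := by
    unfold smlProj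
    rw [weightedHomogeneousComponent_of_mem hT, if_neg hne]
  rw [← relRank_smlProj pos Finset.univ (∏ i, g (e i)), hzero, relRank_zero]

/-- **Fewnomial bound** `relrk_{[d]}(g(Σ_j a_j ∏_i X_{e j i})) ≤ |J|·2^{-(Σ_b |w_b|)/2}`. [cite: LimayeSrinivasanTavenas2025, Claim 7] -/
theorem relRank_aeval_sum_le (hg : IsBlockPreserving blk₀ Sigma.fst g) {J ι' : Type} [Fintype J]
    [Fintype ι'] (a : J → K) (e : J → ι' → σ₀) :
    relRank K pos Finset.univ (aeval g (∑ j, a j • ∏ i, (X (e j i) : MvPolynomial σ₀ K))) ≤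
      Fintype.card J * (2 : ℝ) ^ (-((∑ b : Fin d, letterSize k pos b : ℕ) : ℝ) / 2) := by
  rw [aeval_sum_smul_prod_X]
  refine (relRank_sum_smul_le pos Finset.univ Finset.univ a fun j => ∏ i, g (e j i)).trans ?_
  refine (Finset.sum_le_sum fun j _ => ?_).trans (by rw [Finset.sum_const, Finset.card_univ, nsmul_eq_mul])
  by_cases hb : Function.Bijective fun i => blk₀ (e j i)
  · exact relRank_prod_le_of_bijective hg (e j) hb
  · rw [relRank_prod_eq_zero_of_not_bijective hg (e j) hb]; positivity

end Word

/-- `|J| ≤ 2^{2d²}`, `1 ≤ d`, `10 d ≤ k` ⇒ `|J| · 2^{-(Σ_b|w_b|)/2} ≤ Φ_Δ(d) = 2^{-k d^{μ_Δ}/20}` (via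
`Σ_b |w_b| ≥ d ⌊k/√2⌋ ≥ d (0.7 k - 1)` and `d^{μ_Δ} ≤ d`). [folklore] -/
theorem card_mul_two_pow_le_Phi {d k : ℕ} (pos : Fin d → Bool) (hd : 1 ≤ d) (hk : 10 * d ≤ k) {M : ℕ}
    (hM : M ≤ 2 ^ (2 * d ^ 2)) (Δ : ℕ) :
    (M : ℝ) * (2 : ℝ) ^ (-((∑ b : Fin d, letterSize k pos b : ℕ) : ℝ) / 2) ≤ Phi k Δ d := by
  have hsum : d * posLetter k ≤ ∑ b : Fin d, letterSize k pos b :=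
    calc d * posLetter k = ∑ _b : Fin d, posLetter k := by
          rw [Finset.sum_const, Finset.card_univ, Fintype.card_fin, smul_eq_mul]
      _ ≤ ∑ b, letterSize k pos b := Finset.sum_le_sum fun b _ => by
          unfold letterSize; split_ifs; exacts [le_rfl, posLetter_le k]
  generalize (∑ b : Fin d, letterSize k pos b) = L at hsum ⊢
  obtain ⟨hk', hk0⟩ : (10 : ℝ) * d ≤ k ∧ (0 : ℝ) ≤ k := ⟨by exact_mod_cast hk, Nat.cast_nonneg k⟩
  have hs : Real.sqrt 2 ≤ 10 / 7 := (Real.sqrt_le_left (by norm_num)).2 (by norm_num)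
  have hP : (7 / 10 : ℝ) * k ≤ k / Real.sqrt 2 := by
    rw [le_div_iff₀ sqrt_two_pos]
    nlinarith [mul_le_mul_of_nonneg_left hs hk0]
  have hP' : (7 / 10 : ℝ) * k - 1 ≤ (posLetter k : ℝ) := by linarith [sub_one_lt_posLetter k]
  have hdL : (d : ℝ) * (posLetter k : ℝ) ≤ L := by exact_mod_cast hsum
  have hL : (d : ℝ) * ((7 / 10 : ℝ) * k - 1) ≤ L := (mul_le_mul_of_nonneg_left hP' (Nat.cast_nonneg _)).trans hdL
  have hμ : (d : ℝ) ^ mu Δ ≤ d := by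
    simpa only [Real.rpow_one] using Real.rpow_le_rpow_of_exponent_le (by exact_mod_cast hd) (mu_le_one Δ)
  have h3 : (k : ℝ) * (d : ℝ) ^ mu Δ ≤ k * d := mul_le_mul_of_nonneg_left hμ hk0
  have h4 : (3 : ℝ) * d ^ 2 ≤ 3 / 10 * d * k := by
    nlinarith [mul_nonneg (sub_nonneg.2 hk') (Nat.cast_nonneg (α := ℝ) d)]
  have h5 : (d : ℝ) ≤ d ^ 2 := by nlinarith [show (1 : ℝ) ≤ d by exact_mod_cast hd, sq_nonneg ((d : ℝ) - 1)]
  have hexp : ((2 * d ^ 2 : ℕ) : ℝ) + -(L : ℝ) / 2 ≤ -(k : ℝ) * (d : ℝ) ^ mu Δ / 20 := by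
    push_cast; linarith
  have hM' : (M : ℝ) ≤ (2 : ℝ) ^ ((2 * d ^ 2 : ℕ) : ℝ) := by rw [Real.rpow_natCast]; exact_mod_cast hM
  calc (M : ℝ) * (2 : ℝ) ^ (-(L : ℝ) / 2) ≤ (2 : ℝ) ^ ((2 * d ^ 2 : ℕ) : ℝ) * (2 : ℝ) ^ (-(L : ℝ) / 2) :=
        mul_le_mul_of_nonneg_right hM' (by positivity)
    _ = (2 : ℝ) ^ (((2 * d ^ 2 : ℕ) : ℝ) + -(L : ℝ) / 2) := (Real.rpow_add (by norm_num) _ _).symm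
    _ ≤ (2 : ℝ) ^ (-(k : ℝ) * (d : ℝ) ^ mu Δ / 20) := Real.rpow_le_rpow_of_exponent_le (by norm_num) hexp
    _ = Phi k Δ d := by rw [Phi]

/-- **Fewnomial blindness of the LST pipeline** (general form): a `K`-combination of products of variables — at
most `2^{2d²}` terms if they have exactly `d` factors, else unrestricted (measure `0`) — is never LST-certified, at
any size `s` (even `s = 0`), product depth, block map, over any field. [cite: LimayeSrinivasanTavenas2025, Lemma 15] -/
theorem not_lstCertifies_sum' {σ₀ : Type} [Fintype σ₀] {d : ℕ} (blk₀ : σ₀ → Fin d) {J ι' : Type}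
    [Fintype J] [Fintype ι'] (hJ : Fintype.card ι' = d → Fintype.card J ≤ 2 ^ (2 * d ^ 2)) (a : J → K)
    (e : J → ι' → σ₀) (s Δ : ℕ) :
    ¬ LSTCertifies blk₀ (∑ j, a j • ∏ i, (X (e j i) : MvPolynomial σ₀ K)) s Δ := by
  classical
  rintro ⟨k, pos, g, hk, hg, hlt⟩
  obtain ⟨hΛ, hΦ⟩ : (1 : ℝ) ≤ Lam s (Fintype.card σ₀) d Δ ∧ 0 < Phi k Δ d := ⟨one_le_Lam _ _ _ _, Phi_pos k Δ d⟩
  refine (not_lt.2 ?_) hlt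
  by_cases hι : Fintype.card ι' = d
  swap
  · rw [aeval_sum_smul_prod_X]
    refine (relRank_sum_smul_le pos Finset.univ Finset.univ a fun j => ∏ i, g (e j i)).trans ?_
    rw [Finset.sum_eq_zero fun j _ => relRank_prod_eq_zero_of_not_bijective hg (e j) fun hb =>
      hι (by simpa using Fintype.card_of_bijective hb)]
    positivity
  rcases Nat.eq_zero_or_pos d with hd | hd
  · subst hd
    have hPhi : Phi k Δ (0 : ℕ) = 1 := by
      rw [Phi, Nat.cast_zero, Real.zero_rpow (mu_pos Δ).ne', mul_zero, zero_div, Real.rpow_zero]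
    rw [hPhi, mul_one]
    exact (relRank_le_one pos _ _).trans hΛ
  · calc relRank K pos Finset.univ (aeval g (∑ j, a j • ∏ i, (X (e j i) : MvPolynomial σ₀ K)))
        ≤ Fintype.card J * (2 : ℝ) ^ (-((∑ b : Fin d, letterSize k pos b : ℕ) : ℝ) / 2) :=
          relRank_aeval_sum_le hg a e
      _ ≤ Phi k Δ d := card_mul_two_pow_le_Phi pos hd hk (hJ hι) Δ
      _ ≤ Lam s (Fintype.card σ₀) d Δ * Phi k Δ d := le_mul_of_one_le_left hΦ.le hΛ

/-- **Fewnomial blindness of the LST pipeline**: a `K`-combination of at most `2^{2d²}` products of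
variables is never LST-certified, at any size `s`. [cite: LimayeSrinivasanTavenas2025, Lemma 15] -/
theorem not_lstCertifies_sum {σ₀ : Type} [Fintype σ₀] {d : ℕ} (blk₀ : σ₀ → Fin d) {J ι' : Type}
    [Fintype J] [Fintype ι'] (hJ : Fintype.card J ≤ 2 ^ (2 * d ^ 2)) (a : J → K)
    (e : J → ι' → σ₀) (s Δ : ℕ) :
    ¬ LSTCertifies blk₀ (∑ j, a j • ∏ i, (X (e j i) : MvPolynomial σ₀ K)) s Δ :=
  not_lstCertifies_sum' blk₀ (fun _ => hJ) a e s Δ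

/-- `n! ≤ 2^{2n²}`. [folklore] -/
theorem factorial_le_two_pow_sq (n : ℕ) : Nat.factorial n ≤ 2 ^ (2 * n ^ 2) :=
  calc Nat.factorial n ≤ n ^ n := Nat.factorial_le_pow n
    _ ≤ (2 ^ n) ^ n := Nat.pow_le_pow_left Nat.lt_two_pow_self.le n
    _ = 2 ^ (n * n) := by rw [← pow_mul]
    _ ≤ 2 ^ (2 * n ^ 2) := Nat.pow_le_pow_right (by norm_num) (by nlinarith)

/-- No combination of the `n!` products `∏_i X_{σ i, i}` is LST-certified. [cite: LimayeSrinivasanTavenas2025, Lemma 15] -/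
theorem not_lstCertifies_perm_sum (n d : ℕ) (blk₀ : Fin n × Fin n → Fin d) (a : Equiv.Perm (Fin n) → K) (s Δ : ℕ) :
    ¬ LSTCertifies blk₀ (∑ σ : Equiv.Perm (Fin n), a σ • ∏ i, (X (σ i, i) : MvPolynomial (Fin n × Fin n) K)) s Δ := by
  refine not_lstCertifies_sum' blk₀ (fun hnd => ?_) a (fun σ i => (σ i, i)) s Δ
  rw [Fintype.card_fin] at hnd; subst hnd; rw [Fintype.card_perm, Fintype.card_fin]
  exact factorial_le_two_pow_sq n

/-- `per_n = Σ_σ 1 • ∏_i X_{σ i, i}`. [cite: Burgisser2000, (2.2)] -/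
theorem perPoly_eq_sum (n : ℕ) : perPoly (Fin n) K =
    ∑ σ : Equiv.Perm (Fin n), (1 : K) • ∏ i, (X (σ i, i) : MvPolynomial (Fin n × Fin n) K) := by
  simp only [perPoly, Matrix.permanent, Matrix.mvPolynomialX_apply, one_smul]

/-- `det_n = Σ_σ sign(σ) • ∏_i X_{σ i, i}`. [cite: Burgisser2000, (2.1)] -/
theorem detPoly_eq_sum (n : ℕ) : detPoly (Fin n) K = ∑ σ : Equiv.Perm (Fin n),
    ((Equiv.Perm.sign σ : ℤ) : K) • ∏ i, (X (σ i, i) : MvPolynomial (Fin n × Fin n) K) := by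
  simp only [detPoly, Matrix.det_apply', Matrix.mvPolynomialX_apply, MvPolynomial.smul_eq_C_mul, map_intCast]

/-- **The LST relative-rank pipeline is blind to the permanent**: for every `n`, number of blocks `d`, block map
`blk₀`, size `s`, product depth `Δ`, every field: `¬ LSTCertifies blk₀ per_n s Δ`. [cite: LimayeSrinivasanTavenas2025, Lemma 15] -/
theorem not_lstCertifies_perPoly (n d : ℕ) (blk₀ : Fin n × Fin n → Fin d) (s Δ : ℕ) :
    ¬ LSTCertifies blk₀ (perPoly (Fin n) K) s Δ := by
  rw [perPoly_eq_sum]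
  exact not_lstCertifies_perm_sum n d blk₀ (fun _ => (1 : K)) s Δ

/-- The same for the determinant. [cite: LimayeSrinivasanTavenas2025, Lemma 15] -/
theorem not_lstCertifies_detPoly (n d : ℕ) (blk₀ : Fin n × Fin n → Fin d) (s Δ : ℕ) :
    ¬ LSTCertifies blk₀ (detPoly (Fin n) K) s Δ := by
  rw [detPoly_eq_sum]
  exact not_lstCertifies_perm_sum n d blk₀ (fun σ => ((Equiv.Perm.sign σ : ℤ) : K)) s Δ

end

end Summit.ValiantsHypothesis.ValiantsHypothesis.Theorems.LSTPipelinePer
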